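import Summits.BirchSwinnertonDyer.BirchSwinnertonDyer.Theorems.ResidualThetaTransportAtTwoThetaLayerLambdaCongruenceAtTwoDepletedGrowth
import HarnessLib

/-!
# Crux `ThetaLayerLambdaCongruenceAtTwo` (stmt-BirchSwinnertonDyer-20688), line `birth`: the three-term relation and the
# `λ`-growth law for GENERIC depletions, under STABILISATION of the sup norm (no `μ = 0` needed)

Width seat bsd-wall-rtt-p3-w3 (`--supports stmt-BirchSwinnertonDyer-20688`; closes nothing). THEOREMS ONLY, route-independent.

Let `g` be a newform on `Γ₀(M)`, `2 ∤ M`, `a₂(g) = 0`, `Ω` a PLUS period (not necessarily cohomological), `ι : K_g → ℚ̄₂`, and let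
`E_k = ∏_{a∈S} Q_a ∘ (c_a·(X+1)^{(x_a mod 2^k)})` be ANY "depletion" built from polynomials `Q_a ∈ ℚ̄₂[X]`, scalars `c_a` and
`2`-adic exponents `x_a ∈ ℤ₂` (the crux's `W`-side AND `g`-side Euler products are of this shape). Put
`F_k = (θ_k(g;Ω)^ι · E_k) %ₘ ω_k`.

* §1 `layer_three_term_generic`: `F_{n+2} %ₘ ω_{n+1} = −((X+1)^{2ⁿ}+1)·F_n` (as in `…DepletedGrowth`, for generic `E`).
* §2 `supNorm_layer_le_add_two_generic`: `‖F_n‖_sup ≤ ‖F_{n+2}‖_sup` — the sup norms are NON-DECREASING along each parity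
  class of layers (for every plus period; no integrality needed); and `layerLambda_layer_add_two_of_stabilized`: if `F_n ≠ 0`
  and `‖F_{n+2}‖_sup ≤ ‖F_n‖_sup` (the norm has STABILISED), then `λ(F_{n+2}) = λ(F_n) + 2ⁿ`. Iterated:
  `layerLambda_layer_add_two_mul_of_stabilized`.

READING. The coefficients of `F_k` lie in a fixed finite extension of `ℚ₂` (`ι(K_g)·ℚ₂`, resp. `ℚ₂` on the `W`-side), whose norm
values are DISCRETE; a non-decreasing bounded sequence of such norms is eventually constant. So for BOTH sides of the crux the
`λ`-growth law `λ_{n+2} = λ_n + 2ⁿ` holds from some (non-effective) layer on, with NO `μ = 0` input; consequently the difference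
`λ(Θ^{S₀}_n(W)) − λ(Θ^{S₀}_n(g;Ω))` is EVENTUALLY CONSTANT along even `n`, and the crux Kan⁺ says that this constant is `0` —
equivalently, that the two `λ`'s agree at ONE even layer beyond both stabilisation points (companion file `…OneLayerCrux`).
The discreteness step is not formalised here (it is the only missing input for the unconditional eventual growth law).

Nothing about any curve or form is asserted; BSD is not proved by any of this.

References: [PollackWeston2011MT] Prop. 2.5, §3.1, Thm. 4.1, §4; [GreenbergVatsal2000] §2.
-/

noncomputable section

-- justification: the `Summit.BirchSwinnertonDyer.BirchSwinnertonDyer.…` path repeats a component (route-file convention)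
set_option linter.dupNamespace false

open scoped Classical

open Polynomial

open Literature.NumberTheory.IwasawaTheory Literature.NumberTheory.EllipticCurves
  Literature.NumberTheory.EllipticCurves.ModularForms

namespace Summit.BirchSwinnertonDyer.BirchSwinnertonDyer.Theorems.ThetaLayerLambdaCongruenceAtTwo

section Generic

variable {M : ℕ} [NeZero M] {g : CuspForm (CongruenceSubgroup.Gamma0 M) 2}
  (ι : coeffField g →+* PadicAlgCl 2) (Ω : ℂ)
  {α : Type*} (S : Finset α) (Q : α → (PadicAlgCl 2)[X]) (c : α → PadicAlgCl 2) (x : α → ℤ_[2])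

/-! ## §1. The three-term relation for a generic depletion -/

omit [NeZero M] in
/-- **Generic depletions are compatible along the tower**: `ω_n ∣ E_{n+2} − E_n` for
`E_k = ∏_{a∈S} Q_a ∘ (c_a·(X+1)^{(x_a mod 2^k)})`. [folklore] -/
theorem layerModulus_dvd_genericEuler_add_two_sub (n : ℕ) :
    ((X + 1 : (PadicAlgCl 2)[X]) ^ 2 ^ n - 1) ∣
      (∏ a ∈ S, (Q a).comp (C (c a) * (X + 1) ^ (PadicInt.toZModPow (n + 2) (x a)).val)) -
        ∏ a ∈ S, (Q a).comp (C (c a) * (X + 1) ^ (PadicInt.toZModPow n (x a)).val) := by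
  refine dvd_prod_sub_prod _ _ _ _ fun a _ ↦ dvd_comp_sub_comp _ _ _ _ ?_
  obtain ⟨q, hq⟩ := exists_val_toZModPow_add_two_eq n (x a)
  rw [hq, ← mul_sub]
  exact Dvd.dvd.mul_left (layerModulus_dvd_pow_add_sub_pow n _ q) _

/-- **THREE-TERM RELATION for a generic depletion** (`2 ∤ M`, `a₂(g) = 0`, `Ω` a plus period): with
`F_k = (θ_k(g;Ω)^ι·E_k) %ₘ ω_k`, `F_{n+2} %ₘ ω_{n+1} = −((X+1)^{2ⁿ}+1)·F_n`. Same proof as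
`depletedPartnerLayer_three_term`. [cite: PollackWeston2011MT, Prop. 2.5 (three-term relation, a_p = 0; read at 2 for imprimitive elements)] -/
theorem layer_three_term_generic (hg : IsNewform0 g) (h2M : ¬ 2 ∣ M) (ha2 : cuspCoeff g 2 = 0) (hΩ : IsPlusPeriod g Ω)
    (n : ℕ) :
    (((mazurTateElementK g Ω 2 (n + 2)).map ι *
        ∏ a ∈ S, (Q a).comp (C (c a) * (X + 1) ^ (PadicInt.toZModPow (n + 2) (x a)).val)) %ₘ
        ((X + 1) ^ 2 ^ (n + 2) - 1)) %ₘ ((X + 1) ^ 2 ^ (n + 1) - 1) =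
      -(((X + 1) ^ 2 ^ n + 1) *
        (((mazurTateElementK g Ω 2 n).map ι *
          ∏ a ∈ S, (Q a).comp (C (c a) * (X + 1) ^ (PadicInt.toZModPow n (x a)).val)) %ₘ
          ((X + 1) ^ 2 ^ n - 1))) := by
  set ν : (PadicAlgCl 2)[X] := (X + 1) ^ 2 ^ n + 1 with hν
  set ω0 : (PadicAlgCl 2)[X] := (X + 1) ^ 2 ^ n - 1 with hω0
  set ω1 : (PadicAlgCl 2)[X] := (X + 1) ^ 2 ^ (n + 1) - 1 with hω1
  set ω2 : (PadicAlgCl 2)[X] := (X + 1) ^ 2 ^ (n + 2) - 1 with hω2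
  set E0 : (PadicAlgCl 2)[X] := ∏ a ∈ S, (Q a).comp (C (c a) * (X + 1) ^ (PadicInt.toZModPow n (x a)).val)
    with hE0
  set E2 : (PadicAlgCl 2)[X] :=
    ∏ a ∈ S, (Q a).comp (C (c a) * (X + 1) ^ (PadicInt.toZModPow (n + 2) (x a)).val) with hE2
  set A : (PadicAlgCl 2)[X] :=
    (∑ i ∈ Finset.range (2 ^ n), C (plusSymbolK g Ω ((5 : ℚ) ^ i / (2 : ℚ) ^ (n + 2))) * (X + 1) ^ i).map ι with hA
  set B : (PadicAlgCl 2)[X] :=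
    (∑ i ∈ Finset.range (2 ^ (n + 2)), C (plusSymbolK g Ω ((5 : ℚ) ^ i / (2 : ℚ) ^ (n + 2 + 2))) *
      (X + 1) ^ i).map ι with hB
  have hθn : (mazurTateElementK g Ω 2 n).map ι = C (2 : PadicAlgCl 2) * A :=
    map_mazurTateElementK_two_eq_C_two_mul_map_sum_range ι Ω n
  have hθn2 : (mazurTateElementK g Ω 2 (n + 2)).map ι = C (2 : PadicAlgCl 2) * B :=
    map_mazurTateElementK_two_eq_C_two_mul_map_sum_range ι Ω (n + 2)
  rw [hθn, hθn2]
  have hνω : ν * ω0 = ω1 := X_add_one_pow_add_one_mul_layerModulus n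
  have hω1m : ω1.Monic := monic_layerModulus (p := 2) (n + 1)
  have hω0m : ω0.Monic := monic_layerModulus (p := 2) n
  -- the undepleted relation through `ι`
  have h3 : B %ₘ ω1 = -(ν * A) := by
    have hωm : ((X + 1 : (coeffField g)[X]) ^ 2 ^ (n + 1) - 1).Monic := by
      have e : (X + 1 : (coeffField g)[X]) = X + C 1 := by rw [C_1]
      have hlt : (1 : (coeffField g)[X]).natDegree < ((X + 1 : (coeffField g)[X]) ^ 2 ^ (n + 1)).natDegree := by
        rw [e, natDegree_pow, natDegree_X_add_C, mul_one, natDegree_one]; exact pow_pos two_pos _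
      exact Monic.sub_of_left (by rw [e]; exact (monic_X_add_C 1).pow _) (degree_lt_degree hlt)
    have h0 := congr_arg (Polynomial.map ι) (halfLayer_three_term Ω hg h2M ha2 hΩ n)
    simp only [Polynomial.map_modByMonic ι hωm, Polynomial.map_sub, Polynomial.map_pow, Polynomial.map_add,
      Polynomial.map_X, Polynomial.map_one, Polynomial.map_neg, Polynomial.map_mul] at h0
    rw [hB, hν, hA]
    exact h0
  have hdB : ω1 ∣ B + ν * A := by
    have := modByMonic_add_div B ω1
    rw [h3] at this
    exact ⟨B /ₘ ω1, by linear_combination -this⟩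
  have hdE : ω0 ∣ E2 - E0 := layerModulus_dvd_genericEuler_add_two_sub S Q c x n
  have hdT : ω0 ∣ C (2 : PadicAlgCl 2) * A * E0 - (C (2 : PadicAlgCl 2) * A * E0) %ₘ ω0 := by
    have := modByMonic_add_div (C (2 : PadicAlgCl 2) * A * E0) ω0
    exact ⟨(C (2 : PadicAlgCl 2) * A * E0) /ₘ ω0, by linear_combination -this⟩
  have hkey : ω1 ∣ C (2 : PadicAlgCl 2) * B * E2 - -(ν * ((C (2 : PadicAlgCl 2) * A * E0) %ₘ ω0)) := by
    have e : C (2 : PadicAlgCl 2) * B * E2 - -(ν * ((C (2 : PadicAlgCl 2) * A * E0) %ₘ ω0)) =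
        C (2 : PadicAlgCl 2) * E2 * (B + ν * A) - ν * (C (2 : PadicAlgCl 2) * A * (E2 - E0)) -
          ν * (C (2 : PadicAlgCl 2) * A * E0 - (C (2 : PadicAlgCl 2) * A * E0) %ₘ ω0) := by ring
    rw [e]
    refine dvd_sub (dvd_sub (Dvd.dvd.mul_left hdB _) ?_) ?_
    · rw [← hνω]; exact mul_dvd_mul_left ν (Dvd.dvd.mul_left hdE _)
    · rw [← hνω]; exact mul_dvd_mul_left ν hdT
  have hred : (C (2 : PadicAlgCl 2) * B * E2) %ₘ ω2 %ₘ ω1 = (C (2 : PadicAlgCl 2) * B * E2) %ₘ ω1 := by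
    apply modByMonic_eq_of_dvd_sub hω1m
    have := modByMonic_add_div (C (2 : PadicAlgCl 2) * B * E2) ω2
    refine ((layerModulus_dvd_layerModulus_succ (n + 1)).trans ⟨-((C (2 : PadicAlgCl 2) * B * E2) /ₘ ω2), ?_⟩)
    rw [hω2]
    linear_combination this
  rw [hred, modByMonic_eq_of_dvd_sub hω1m hkey]
  refine (modByMonic_eq_self_iff hω1m).mpr (degree_lt_degree ?_)
  rw [natDegree_neg, show ω1.natDegree = 2 ^ (n + 1) from natDegree_layerModulus (p := 2) (n + 1)]
  refine (natDegree_mul_le).trans_lt ?_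
  have hν' : ν.natDegree ≤ 2 ^ n := by
    refine (natDegree_add_le _ _).trans (max_le ?_ (by rw [natDegree_one]; exact Nat.zero_le _))
    rw [show (X + 1 : (PadicAlgCl 2)[X]) = X + C 1 by rw [C_1], natDegree_pow, natDegree_X_add_C, mul_one]
  have hΘ : ((C (2 : PadicAlgCl 2) * A * E0) %ₘ ω0).natDegree < 2 ^ n := by
    have h := natDegree_modByMonic_lt (C (2 : PadicAlgCl 2) * A * E0) hω0m (by
      intro h1
      have := congr_arg natDegree h1
      rw [show ω0.natDegree = 2 ^ n from natDegree_layerModulus (p := 2) n, natDegree_one] at this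
      exact absurd this (pow_ne_zero _ two_ne_zero))
    rwa [show ω0.natDegree = 2 ^ n from natDegree_layerModulus (p := 2) n] at h
  calc ν.natDegree + ((C (2 : PadicAlgCl 2) * A * E0) %ₘ ω0).natDegree < 2 ^ n + 2 ^ n :=
        Nat.add_lt_add_of_le_of_lt hν' hΘ
    _ = 2 ^ (n + 1) := by rw [pow_succ]; ring

/-! ## §2. Monotonicity of the sup norm and growth under stabilisation -/

/-- **The sup norms of the layer elements are non-decreasing along each parity class** (generic depletion, any plus
period): `‖F_n‖_sup ≤ ‖F_{n+2}‖_sup`, since `‖F_{n+2}‖ ≥ ‖F_{n+2} %ₘ ω_{n+1}‖ = ‖((X+1)^{2ⁿ}+1)·F_n‖ = ‖F_n‖`.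
[cite: PollackWeston2011MT, §4 (μ(θ_{n+1}) ≤ μ(θ_{n−1}) for a_p = 0; read at 2)] -/
theorem supNorm_layer_le_add_two_generic (hg : IsNewform0 g) (h2M : ¬ 2 ∣ M) (ha2 : cuspCoeff g 2 = 0)
    (hΩ : IsPlusPeriod g Ω) (n : ℕ) :
    (((mazurTateElementK g Ω 2 n).map ι *
        ∏ a ∈ S, (Q a).comp (C (c a) * (X + 1) ^ (PadicInt.toZModPow n (x a)).val)) %ₘ
        ((X + 1) ^ 2 ^ n - 1)).supNorm ≤
      (((mazurTateElementK g Ω 2 (n + 2)).map ι *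
        ∏ a ∈ S, (Q a).comp (C (c a) * (X + 1) ^ (PadicInt.toZModPow (n + 2) (x a)).val)) %ₘ
        ((X + 1) ^ 2 ^ (n + 2) - 1)).supNorm := by
  have h3 := layer_three_term_generic ι Ω S Q c x hg h2M ha2 hΩ n
  obtain ⟨hPn, -⟩ := supNorm_and_layerLambda_X_add_one_pow_two_pow_add_one n
  refine le_trans ?_ (supNorm_modByMonic_le (monic_layerModulus (p := 2) (n + 1))
    (supNorm_layerModulus_le_one (p := 2) (n + 1)) _)
  rw [h3, show ∀ F : (PadicAlgCl 2)[X], -F = C (-1 : PadicAlgCl 2) * F from fun F ↦ by simp, supNorm_C_mul, norm_neg,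
    norm_one, one_mul, supNorm_mul', hPn, one_mul]

/-- **`λ`-GROWTH UNDER STABILISATION** (generic depletion, any plus period): if `F_n ≠ 0` and the sup norm has stabilised,
`‖F_{n+2}‖_sup ≤ ‖F_n‖_sup`, then `‖F_{n+2}‖_sup = ‖F_n‖_sup` and `λ(F_{n+2}) = λ(F_n) + 2ⁿ`. No `μ = 0` and no integrality is
needed — only that the norm does not jump at this step. [cite: PollackWeston2011MT, Thm. 4.1 (λ(θ_n) = q_n + λ; read at 2)] -/
theorem layerLambda_layer_add_two_of_stabilized (hg : IsNewform0 g) (h2M : ¬ 2 ∣ M) (ha2 : cuspCoeff g 2 = 0)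
    (hΩ : IsPlusPeriod g Ω) {n : ℕ}
    (h0 : (((mazurTateElementK g Ω 2 n).map ι *
        ∏ a ∈ S, (Q a).comp (C (c a) * (X + 1) ^ (PadicInt.toZModPow n (x a)).val)) %ₘ
        ((X + 1) ^ 2 ^ n - 1)) ≠ 0)
    (hstab : (((mazurTateElementK g Ω 2 (n + 2)).map ι *
        ∏ a ∈ S, (Q a).comp (C (c a) * (X + 1) ^ (PadicInt.toZModPow (n + 2) (x a)).val)) %ₘ
        ((X + 1) ^ 2 ^ (n + 2) - 1)).supNorm ≤
      (((mazurTateElementK g Ω 2 n).map ι *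
        ∏ a ∈ S, (Q a).comp (C (c a) * (X + 1) ^ (PadicInt.toZModPow n (x a)).val)) %ₘ
        ((X + 1) ^ 2 ^ n - 1)).supNorm) :
    (((mazurTateElementK g Ω 2 (n + 2)).map ι *
        ∏ a ∈ S, (Q a).comp (C (c a) * (X + 1) ^ (PadicInt.toZModPow (n + 2) (x a)).val)) %ₘ
        ((X + 1) ^ 2 ^ (n + 2) - 1)).supNorm =
      (((mazurTateElementK g Ω 2 n).map ι *
        ∏ a ∈ S, (Q a).comp (C (c a) * (X + 1) ^ (PadicInt.toZModPow n (x a)).val)) %ₘ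
        ((X + 1) ^ 2 ^ n - 1)).supNorm ∧
    layerLambda (((mazurTateElementK g Ω 2 (n + 2)).map ι *
        ∏ a ∈ S, (Q a).comp (C (c a) * (X + 1) ^ (PadicInt.toZModPow (n + 2) (x a)).val)) %ₘ
        ((X + 1) ^ 2 ^ (n + 2) - 1)) =
      layerLambda (((mazurTateElementK g Ω 2 n).map ι *
        ∏ a ∈ S, (Q a).comp (C (c a) * (X + 1) ^ (PadicInt.toZModPow n (x a)).val)) %ₘ
        ((X + 1) ^ 2 ^ n - 1)) + 2 ^ n := by
  obtain ⟨hPn, hPl⟩ := supNorm_and_layerLambda_X_add_one_pow_two_pow_add_one n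
  set P : (PadicAlgCl 2)[X] := (X + 1) ^ 2 ^ n + 1 with hP
  set F0 := (((mazurTateElementK g Ω 2 n).map ι *
        ∏ a ∈ S, (Q a).comp (C (c a) * (X + 1) ^ (PadicInt.toZModPow n (x a)).val)) %ₘ
        ((X + 1) ^ 2 ^ n - 1)) with hF0
  set F2 := (((mazurTateElementK g Ω 2 (n + 2)).map ι *
        ∏ a ∈ S, (Q a).comp (C (c a) * (X + 1) ^ (PadicInt.toZModPow (n + 2) (x a)).val)) %ₘ
        ((X + 1) ^ 2 ^ (n + 2) - 1)) with hF2
  have h3 : F2 %ₘ ((X + 1) ^ 2 ^ (n + 1) - 1) = -(P * F0) := layer_three_term_generic ι Ω S Q c x hg h2M ha2 hΩ n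
  have hmono : F0.supNorm ≤ F2.supNorm := supNorm_layer_le_add_two_generic ι Ω S Q c x hg h2M ha2 hΩ n
  have heq : F2.supNorm = F0.supNorm := le_antisymm hstab hmono
  have hpos : 0 < F0.supNorm := lt_of_le_of_ne (supNorm_nonneg _) (Ne.symm ((supNorm_eq_zero_iff _).not.mpr h0))
  have hRn : (-(P * F0)).supNorm = F0.supNorm := by
    rw [show -(P * F0) = C (-1 : PadicAlgCl 2) * (P * F0) by simp, supNorm_C_mul, norm_neg, norm_one, one_mul,
      supNorm_mul', hPn, one_mul]
  have hF2z : F2 ≠ 0 := fun hz ↦ by rw [hz, supNorm_zero] at heq; exact hpos.ne heq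
  have hP0 : P ≠ 0 := fun hz ↦ by rw [hz, supNorm_zero] at hPn; exact zero_ne_one hPn
  have hsurv : (F2 %ₘ ((X + 1) ^ 2 ^ (n + 1) - 1)).supNorm = F2.supNorm := by rw [h3, hRn, heq]
  have hlam2 : layerLambda F2 < 2 ^ (n + 1) :=
    (supNorm_modByMonic_layerModulus_eq_iff (p := 2) (n + 1) hF2z).mp hsurv
  refine ⟨heq, ?_⟩
  rw [← (layerLambda_modByMonic_layerModulus (p := 2) (n + 1) hF2z hlam2).2, h3,
    show -(P * F0) = C (-1 : PadicAlgCl 2) * (P * F0) by simp,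
    ResidualThetaLayer.layerLambda_C_mul (neg_ne_zero.mpr one_ne_zero), layerLambda_mul hP0 h0, hPl, add_comm]

/-- **Iterated growth under stabilisation**: if `F_n ≠ 0` and `‖F_{n+2k+2}‖_sup ≤ ‖F_{n+2k}‖_sup` for all `k` (the norm has
stabilised from layer `n` on along this parity class), then for every `k`: `F_{n+2k} ≠ 0`, `‖F_{n+2k}‖_sup = ‖F_n‖_sup` and
`3·λ(F_{n+2k}) + 2ⁿ = 3·λ(F_n) + 2ⁿ·4^k`. [cite: PollackWeston2011MT, Thm. 4.1 (read at 2)] -/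
theorem layerLambda_layer_add_two_mul_of_stabilized (hg : IsNewform0 g) (h2M : ¬ 2 ∣ M) (ha2 : cuspCoeff g 2 = 0)
    (hΩ : IsPlusPeriod g Ω) {n : ℕ}
    (h0 : (((mazurTateElementK g Ω 2 n).map ι *
        ∏ a ∈ S, (Q a).comp (C (c a) * (X + 1) ^ (PadicInt.toZModPow n (x a)).val)) %ₘ
        ((X + 1) ^ 2 ^ n - 1)) ≠ 0)
    (hstab : ∀ k : ℕ, (((mazurTateElementK g Ω 2 (n + 2 * k + 2)).map ι *
        ∏ a ∈ S, (Q a).comp (C (c a) * (X + 1) ^ (PadicInt.toZModPow (n + 2 * k + 2) (x a)).val)) %ₘ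
        ((X + 1) ^ 2 ^ (n + 2 * k + 2) - 1)).supNorm ≤
      (((mazurTateElementK g Ω 2 (n + 2 * k)).map ι *
        ∏ a ∈ S, (Q a).comp (C (c a) * (X + 1) ^ (PadicInt.toZModPow (n + 2 * k) (x a)).val)) %ₘ
        ((X + 1) ^ 2 ^ (n + 2 * k) - 1)).supNorm) (k : ℕ) :
    (((mazurTateElementK g Ω 2 (n + 2 * k)).map ι *
        ∏ a ∈ S, (Q a).comp (C (c a) * (X + 1) ^ (PadicInt.toZModPow (n + 2 * k) (x a)).val)) %ₘ
        ((X + 1) ^ 2 ^ (n + 2 * k) - 1)) ≠ 0 ∧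
    (((mazurTateElementK g Ω 2 (n + 2 * k)).map ι *
        ∏ a ∈ S, (Q a).comp (C (c a) * (X + 1) ^ (PadicInt.toZModPow (n + 2 * k) (x a)).val)) %ₘ
        ((X + 1) ^ 2 ^ (n + 2 * k) - 1)).supNorm =
      (((mazurTateElementK g Ω 2 n).map ι *
        ∏ a ∈ S, (Q a).comp (C (c a) * (X + 1) ^ (PadicInt.toZModPow n (x a)).val)) %ₘ
        ((X + 1) ^ 2 ^ n - 1)).supNorm ∧
    3 * layerLambda (((mazurTateElementK g Ω 2 (n + 2 * k)).map ι *
        ∏ a ∈ S, (Q a).comp (C (c a) * (X + 1) ^ (PadicInt.toZModPow (n + 2 * k) (x a)).val)) %ₘ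
        ((X + 1) ^ 2 ^ (n + 2 * k) - 1)) + 2 ^ n =
      3 * layerLambda (((mazurTateElementK g Ω 2 n).map ι *
        ∏ a ∈ S, (Q a).comp (C (c a) * (X + 1) ^ (PadicInt.toZModPow n (x a)).val)) %ₘ
        ((X + 1) ^ 2 ^ n - 1)) + 2 ^ n * 4 ^ k := by
  induction k with
  | zero => exact ⟨by simpa using h0, by simp, by simp⟩
  | succ k ih =>
    obtain ⟨hz, hn, hl⟩ := ih
    obtain ⟨hn', hl'⟩ := layerLambda_layer_add_two_of_stabilized ι Ω S Q c x hg h2M ha2 hΩ hz (hstab k)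
    change (((mazurTateElementK g Ω 2 (n + 2 * k + 2)).map ι *
        ∏ a ∈ S, (Q a).comp (C (c a) * (X + 1) ^ (PadicInt.toZModPow (n + 2 * k + 2) (x a)).val)) %ₘ
        ((X + 1) ^ 2 ^ (n + 2 * k + 2) - 1)) ≠ 0 ∧
      (((mazurTateElementK g Ω 2 (n + 2 * k + 2)).map ι *
        ∏ a ∈ S, (Q a).comp (C (c a) * (X + 1) ^ (PadicInt.toZModPow (n + 2 * k + 2) (x a)).val)) %ₘ
        ((X + 1) ^ 2 ^ (n + 2 * k + 2) - 1)).supNorm =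
      (((mazurTateElementK g Ω 2 n).map ι *
        ∏ a ∈ S, (Q a).comp (C (c a) * (X + 1) ^ (PadicInt.toZModPow n (x a)).val)) %ₘ
        ((X + 1) ^ 2 ^ n - 1)).supNorm ∧
      3 * layerLambda (((mazurTateElementK g Ω 2 (n + 2 * k + 2)).map ι *
        ∏ a ∈ S, (Q a).comp (C (c a) * (X + 1) ^ (PadicInt.toZModPow (n + 2 * k + 2) (x a)).val)) %ₘ
        ((X + 1) ^ 2 ^ (n + 2 * k + 2) - 1)) + 2 ^ n =
      3 * layerLambda (((mazurTateElementK g Ω 2 n).map ι *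
        ∏ a ∈ S, (Q a).comp (C (c a) * (X + 1) ^ (PadicInt.toZModPow n (x a)).val)) %ₘ
        ((X + 1) ^ 2 ^ n - 1)) + 2 ^ n * 4 ^ (k + 1)
    have hpos : 0 < (((mazurTateElementK g Ω 2 n).map ι *
        ∏ a ∈ S, (Q a).comp (C (c a) * (X + 1) ^ (PadicInt.toZModPow n (x a)).val)) %ₘ
        ((X + 1) ^ 2 ^ n - 1)).supNorm :=
      lt_of_le_of_ne (supNorm_nonneg _) (Ne.symm ((supNorm_eq_zero_iff _).not.mpr h0))
    refine ⟨fun hz' ↦ ?_, hn'.trans hn, ?_⟩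
    · rw [hz', supNorm_zero] at hn'
      rw [← hn, ← hn'] at hpos
      exact lt_irrefl _ hpos
    · rw [hl']
      have e2 : (2 : ℕ) ^ (n + 2 * k) = 2 ^ n * 4 ^ k := by
        rw [pow_add, pow_mul]; norm_num
      linear_combination hl + 3 * e2

end Generic

end Summit.BirchSwinnertonDyer.BirchSwinnertonDyer.Theorems.ThetaLayerLambdaCongruenceAtTwo

end
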